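import Summits.ValiantsHypothesis.ValiantsHypothesis.Theorems.FifoMatchingNNDivisionHardShadowConstReadTilt

/-!
(PART 2 of 7 of the port — part 2 — polylog minors (`T_lt_of_block_polylog`, `exactTilted_body_on_offDiagConst_polylog`) + §3 the junk-tolerant count (`three_pow_le_of_pattern`, `sc_pattern_block`, ★★★ `exactTilted_body_of_partialCommonMax`) + §4 flat-socket decided theorems (`offDiagConst_decided`, `diagonal_decided`, `partialCommonMax_decided`); split for the 400-line cap; texts verbatim by name, docstrings added to helpers.)
# SHADOW-CONSTANT READ / TWIN ROWS — decided classes of the located law of record C′ = `ExactPencilLaw`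

Theorems-side port (staged by the author val-idea-41 g3; press as `Theorems/FifoMatchingNNDivisionHardShadowConstReadPattern.lean`,
`--kind proof --supports stmt-ValiantsHypothesis-21181 --as helper`) of the crux workfile `Cruxes/NNDivisionHard/ShadowConstRead41.lean`
REV 10 @72ea85f2ab68 (sha16 a021d0dfd0d83740, 1482 l., farm rc 0 / 0 sorries / 0 warnings; critic of record val-idea-crit-9 g2: WAVE-6
KEEP/KILL LIST 2026-08-29T00:50:44Z «41 g3 … `ShadowConstRead41` r1→r6 (★★★ `exactTilted_law_on_offDiagConst`, ★★★
`exactTilted_body_of_partialCommonMax`, `offDiagConst_decided`, ★★★★ `twinBlind_decided` / `interSpan_decided` / `blocks_decided` /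
`twinPCM_decided`)» KEPT; revs 7–10 (§5c–§5f) filed after the list's 00:30Z cut, graded in the wave-7 ledger).  Namespace
`Summit.ValiantsHypothesis.ValiantsHypothesis.Theorems.FifoMatching.ShadowConstRead` (parallel to `…LocatedRows`, whose frame — `T`, `RowFamily`, `three_pow_le_of_block`,
`hCOR`, `exactTilted`, `ExactPencilLaw`, `concl_of_lawBody`, `T_lt_of_block'`, `two_pow_half_mul_le` — is used BY NAME).

CONTENT: typed DECIDED CLASSES of the located law C′ (`exactTilted.Law`) in the tree's flat socket
`HasEFOfSize (corPolytope n + convexHull ℝ (Set.range q)) r → T c n < r`: shadow-constant / diagonal passengers (anchored star–clique tilt),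
partial-common-maximiser lists (junk-tolerant Kaibel–Weltge count), twin-blind / twin-PCM lists (antipodal twin rows; every span of 38 g2's
interaction matrices, so `Q_II`), and the twin transfer: a unique top — or a PCM on the top fibre — of ONE entrywise-nonnegative `S × S` pin.

HONEST LABEL: support theorems about the located LAW C′ on CLASSES of passengers, for an OPEN crux; `ExactPencilLaw` (C′), COR-VIRTUAL,
21181 `NNDivisionHard` are OPEN.  VP ≠ VNP is NOT proved here or anywhere in this tree.
-/

set_option autoImplicit false

-- the mandated summit-side namespace repeats a component by design (single-problem summit)
set_option linter.dupNamespace false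

noncomputable section

namespace Summit.ValiantsHypothesis.ValiantsHypothesis.Theorems.FifoMatching.ShadowConstRead

open Matrix Finset
open Literature.Barriers.PneNP (HasEFOfSize three_pow_le_card_mul_two_pow_of_cover_univ)
open Literature.Combinatorics.Optimization.FixedSizePsdRank (Cube bvec flat vecOuter corPolytope flat_dotProduct_vecOuter
  flat_dotProduct_le_of_mem_corPolytope)
open Summit.ValiantsHypothesis.ValiantsHypothesis.Theorems.FifoMatching.XcDivision
  (udInd udPt udRow udMat udInd_apply udInd_sq udInd_inter ud_data udRow_dotProduct_flat_diagonal flat_dotProduct_flat)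
open Summit.ValiantsHypothesis.ValiantsHypothesis.Theorems.FifoMatching.GridCorShadow (four_T_lt_two_pow)
open Summit.ValiantsHypothesis.ValiantsHypothesis.Theorems.FifoMatching.LocatedRows
  (T RowFamily three_pow_le_of_block two_pow_half_mul_le T_lt_of_block' hCOR le_hCOR exists_eq_hCOR flat_le_hCOR exactTilted ExactPencilLaw
    concl_of_lawBody CorVirtualHardN corVirtualHardN_of_exactPencilLaw sum_mul_udInd flat_dotProduct_udPt_eq)
open scoped Pointwise

section Part2
variable {k n : ℕ}

/-! §1 THE FRAME is the tree's, BY NAME: `T`, `RowFamily`, `three_pow_le_of_block`, `hCOR`, `le_hCOR`, `exists_eq_hCOR`, `flat_le_hCOR`,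
`exactTilted`, `ExactPencilLaw`, `concl_of_lawBody` (`…RowFamilies` / `…LocatedRowsColumnCoupled`), `two_pow_half_mul_le` (`…PairPencil`),
`T_lt_of_block'` (`…PinExposed`), `sum_mul_udInd` / `flat_dotProduct_udPt_eq` (`…LocatedRowsCeiling`). -/
/-! ### Polylogarithmic minors suffice (a budget-scale rate lemma, no `n ≤ 2g`) -/

/-- ★ RATE AT THE BUDGET SCALE: `2·(log₂ n + c)^c + 4 ≤ g` and `3^g ≤ (r+1)·2^g` give `T c n < r` — for EVERY `n` (no `n₀`). -/
theorem T_lt_of_block_polylog (c n g r : ℕ) (hg : 2 * (Nat.log 2 n + c) ^ c + 4 ≤ g)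
    (hr : 3 ^ g ≤ (r + 1) * 2 ^ g) : T c n < r := by
  have hpow : 2 ^ (g / 2) * 2 ^ g ≤ (r + 1) * 2 ^ g := (two_pow_half_mul_le g).trans hr
  have hle : 2 ^ (g / 2) ≤ r + 1 := Nat.le_of_mul_le_mul_right hpow (Nat.pos_of_ne_zero (by positivity))
  have hexp : (Nat.log 2 n + c) ^ c + 2 ≤ g / 2 := by omega
  have hT4 : 2 ^ ((Nat.log 2 n + c) ^ c + 2) ≤ 2 ^ (g / 2) := Nat.pow_le_pow_right (by norm_num) hexp
  have hT : 1 ≤ 2 ^ ((Nat.log 2 n + c) ^ c) := Nat.one_le_two_pow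
  unfold T
  rw [pow_add] at hT4
  norm_num at hT4
  omega

/-- ★★★ **POLYLOG MINORS SUFFICE**: a passenger with constant off-diagonal shadow on ANY set `M` with
`|M| ≥ 2·(log₂ n + c)^c + 6` is decided by C′ at `(n, K, q, r)` — for every `n`, literal `T c n < r`.  Hence an ENEMY of
`ExactPencilLaw` at budget `c` must have NON-CONSTANT off-diagonal shadow on EVERY principal minor of polylogarithmic size `2(log₂ n + c)^c + 6`. -/
theorem exactTilted_body_on_offDiagConst_polylog (c₀ n K : ℕ) (q : Fin (K + 1) → (Fin (n * n) → ℝ)) (r : ℕ)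
    (M : Finset (Fin n)) (hM : 2 * (Nat.log 2 n + c₀) ^ c₀ + 6 ≤ M.card) (hq : OffDiagConst M q)
    (m : exactTilted.A n → ℝ) (hm1 : ∀ a j, exactTilted.ρ n a ⬝ᵥ q j ≤ m a) (hm2 : ∀ a, ∃ j, exactTilted.ρ n a ⬝ᵥ q j = m a)
    (U : exactTilted.A n → Option (Fin r) → ℝ) (V : Finset (Fin n) × Fin (K + 1) → Option (Fin r) → ℝ)
    (hU : ∀ a i, 0 ≤ U a i) (hV : ∀ p i, 0 ≤ V p i)
    (hfac : ∀ a b j, (exactTilted.β n a + m a) - exactTilted.ρ n a ⬝ᵥ (udPt b + q j) = ∑ i, U a i * V (b, j) i) :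
    T c₀ n < r := by
  have h2 : 1 < M.card := by omega
  obtain ⟨a₀, ha₀, c, hc, hac⟩ := Finset.one_lt_card.mp h2
  have hblock := sc_block q M hq ha₀ hc hac m hm1 hm2 U V hU hV hfac
  exact T_lt_of_block_polylog c₀ n (M.card - 2) r (by omega) hblock

/-! ## §3 ★★ THE JUNK-TOLERANT COUNT (40 g5 §5c's «count junk-tolerantly», typed): KW needs ZEROS ONLY ON THE `|a ∩ b| = 1` CELLS

`three_pow_le_of_block` asks for the PURE pattern `(1 − |a∩b|)²` on the whole block; Kaibel–Weltge's rectangle argument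
(`three_pow_le_card_mul_two_pow_of_cover_univ`) uses only (Z) slack `= 0` on the cells `|a ∩ b| = 1` and (P) slack `> 0` on the
DISJOINT cells — the cells with `|a ∩ b| ≥ 2` are FREE, and positive passenger junk on disjoint cells is HARMLESS (`three_pow_le_of_pattern`).
For the anchored star–clique rows the COR part of the exact slack on the column `{a₀} ∪ b'` is `(1 − |a'∩b'|)²` (`sc_corSlack`) and the
passenger part `m(a') − ⟨ρ(a'), q_j⟩` is `≥ 0`, so the located read needs exactly: for every column set `b' ⊆ α` ONE listed index `j(b')`
maximising (among the listed points) the rows `a'` with `|a' ∩ b'| = 1` — a PARTIAL common maximiser PER COLUMN (`ScPartialCommonMax`)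
instead of (E17)'s global one (`scPartialCommonMax_of_offDiagConst`: (E17) ⊂ (E18)).  ENEMY SPEC (E18): an enemy of C′ at budget `c`
has, on EVERY anchored configuration `(a₀, c, α)` with `|α| ≥ 2(log₂ n + c)^c + 4`, a column set `b' ⊆ α` whose `|a'∩b'| = 1` rows
admit NO common maximiser among its points (for a cube: some generator on which these directions have BOTH strict signs). -/

/-- ★ PATTERN (junk-tolerant) VERSION of the block count: zeros on the `|a ∩ b| = 1` cells and positive entries on the disjoint cells
of a nonnegatively factorised block already give `3^{|α|} ≤ |ι|·2^{|α|}` (entries on cells with `|a ∩ b| ≥ 2` are arbitrary). -/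
theorem three_pow_le_of_pattern {R C ι α : Type*} [Fintype ι] [Fintype α] [DecidableEq α]
    (U : R → ι → ℝ) (V : C → ι → ℝ) (hU : ∀ ρ i, 0 ≤ U ρ i) (hV : ∀ κ i, 0 ≤ V κ i)
    (row : Finset α → R) (col : Finset α → C)
    (hzero : ∀ a b : Finset α, (a ∩ b).card = 1 → ∑ i, U (row a) i * V (col b) i = 0)
    (hpos : ∀ a b : Finset α, Disjoint a b → 0 < ∑ i, U (row a) i * V (col b) i) :
    3 ^ Fintype.card α ≤ Fintype.card ι * 2 ^ Fintype.card α := by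
  classical
  have key := three_pow_le_card_mul_two_pow_of_cover_univ (α := α) (Finset.univ : Finset ι)
    (fun i => {a : Finset α | 0 < U (row a) i}) (fun i => {b : Finset α | 0 < V (col b) i}) ?_ ?_
  · rwa [Finset.card_univ] at key
  · intro i _ a ha b hb h1
    have ha' : 0 < U (row a) i := ha
    have hb' : 0 < V (col b) i := hb
    have hsum := hzero a b h1
    have hle : U (row a) i * V (col b) i ≤ ∑ j, U (row a) j * V (col b) j :=
      Finset.single_le_sum (f := fun j => U (row a) j * V (col b) j) (fun j _ => mul_nonneg (hU _ j) (hV _ j))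
        (Finset.mem_univ i)
    have hprod : 0 < U (row a) i * V (col b) i := mul_pos ha' hb'
    linarith
  · intro a b hab
    have h := hpos a b hab
    by_contra hne
    have hi : ∀ i, ¬ (0 < U (row a) i ∧ 0 < V (col b) i) := fun i h2 => hne ⟨i, Finset.mem_univ i, h2.1, h2.2⟩
    have hzero' : ∑ i, U (row a) i * V (col b) i = 0 := by
      refine Finset.sum_eq_zero fun i _ => ?_
      by_cases hu : 0 < U (row a) i
      · have hv : ¬ 0 < V (col b) i := fun hv => hi i ⟨hu, hv⟩
        rw [le_antisymm (not_lt.mp hv) (hV _ i), mul_zero]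
      · rw [le_antisymm (not_lt.mp hu) (hU _ i), zero_mul]
    linarith

/-- the embedding of a finite set of the index subtype `↥α` into `Fin n`. -/
def embα (α : Finset (Fin n)) (s : Finset ↥α) : Finset (Fin n) := s.map (Function.Embedding.subtype _)

/-- an element of the embedded subset `embα α s` lies in `α`. -/
theorem mem_of_mem_embα {α : Finset (Fin n)} {s : Finset ↥α} {x : Fin n} (hx : x ∈ embα α s) : x ∈ α := by
  obtain ⟨y, -, rfl⟩ := Finset.mem_map.mp hx
  exact y.2

/-- `embα` commutes with intersections. -/
theorem embα_inter (α : Finset (Fin n)) (s t : Finset ↥α) : embα α s ∩ embα α t = embα α (s ∩ t) :=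
  (Finset.map_inter _ _).symm

/-- `embα` preserves cardinality. -/
theorem card_embα (α : Finset (Fin n)) (s : Finset ↥α) : (embα α s).card = s.card := Finset.card_map _

/-- the anchored star–clique DIRECTION of the row indexed by `a' ⊆ α`: clique part `{a₀}`, tilt `scTilt a₀ ({c} ∪ a')`. -/
noncomputable def scDir (a₀ c : Fin n) (α : Finset (Fin n)) (a' : Finset ↥α) : Fin (n * n) → ℝ :=
  udRow ({a₀} : Finset (Fin n)) + flat (scTilt a₀ (insert c (embα α a')))

/-- ★ THE HYPOTHESIS OF THE JUNK-TOLERANT READ: for every column set `b' ⊆ α`, ONE listed passenger index maximises, among the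
listed points, every anchored star–clique direction `scDir a₀ c α a'` with `|a' ∩ b'| = 1`. -/
def ScPartialCommonMax {K : ℕ} (q : Fin (K + 1) → (Fin (n * n) → ℝ)) (a₀ c : Fin n) (α : Finset (Fin n)) : Prop :=
  ∀ b' : Finset ↥α, ∃ j : Fin (K + 1), ∀ a' : Finset ↥α, (a' ∩ b').card = 1 →
    ∀ j' : Fin (K + 1), scDir a₀ c α a' ⬝ᵥ q j' ≤ scDir a₀ c α a' ⬝ᵥ q j

/-- the COR part of the exact slack of an anchored star–clique row on the column `{a₀} ∪ b'` IS the unique-disjointness entry. -/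
theorem sc_corSlack {a₀ c : Fin n} (α : Finset (Fin n)) (ha₀ : a₀ ∉ α) (hcα : c ∉ α) (hac : a₀ ≠ c) (a' b' : Finset ↥α) :
    (1 + hCOR (scTilt a₀ (insert c (embα α a')))) - scDir a₀ c α a' ⬝ᵥ udPt (insert a₀ (embα α b'))
      = (1 - ((a' ∩ b').card : ℝ)) ^ 2 := by
  classical
  have hA_a₀ : a₀ ∉ insert c (embα α a') := fun h => by
    rcases Finset.mem_insert.mp h with h | h
    · exact hac h
    · exact ha₀ (mem_of_mem_embα h)
  have hc_col : c ∉ insert a₀ (embα α b') := fun h => by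
    rcases Finset.mem_insert.mp h with h | h
    · exact hac h.symm
    · exact hcα (mem_of_mem_embα h)
  have hinter : insert c (embα α a') ∩ insert a₀ (embα α b') = embα α (a' ∩ b') := by
    rw [Finset.insert_inter_of_notMem hc_col, Finset.inter_insert_of_notMem (fun h => ha₀ (mem_of_mem_embα h))]
    exact embα_inter α a' b'
  unfold scDir
  rw [hCOR_scTilt a₀ hA_a₀ (Finset.mem_insert_self _ _), add_dotProduct, udRow_singleton_dot a₀ (Finset.mem_insert_self _ _),
    scTilt_dot_of_mem a₀ _ (Finset.mem_insert_self _ _), hinter, card_embα]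
  ring

/-- ★★ THE JUNK-TOLERANT LOCATED BLOCK.  For ANY passenger list `q`, if ONE anchored configuration `(a₀, c, α)` (`a₀, c ∉ α`, `a₀ ≠ c`)
has a partial common maximiser per column (`ScPartialCommonMax`), then ANY admissible row maxima and ANY nonnegative factorization of the
exact-law located slack of `(COR(n), q)` through `Option (Fin r)` give `3^{|α|} ≤ (r+1)·2^{|α|}` — zeros on the `|a'∩b'| = 1` cells
(COR part `0`, passenger part `0` by maximality), positive entries `≥ 1` on the disjoint cells, the rest is junk and ignored. -/
theorem sc_pattern_block {K r : ℕ} (q : Fin (K + 1) → (Fin (n * n) → ℝ)) {a₀ c : Fin n} (α : Finset (Fin n))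
    (ha₀ : a₀ ∉ α) (hcα : c ∉ α) (hac : a₀ ≠ c) (hpcm : ScPartialCommonMax q a₀ c α)
    (mrow : exactTilted.A n → ℝ) (hm1 : ∀ a j, exactTilted.ρ n a ⬝ᵥ q j ≤ mrow a)
    (hm2 : ∀ a, ∃ j, exactTilted.ρ n a ⬝ᵥ q j = mrow a)
    (U : exactTilted.A n → Option (Fin r) → ℝ) (V : Finset (Fin n) × Fin (K + 1) → Option (Fin r) → ℝ)
    (hU : ∀ a i, 0 ≤ U a i) (hV : ∀ p i, 0 ≤ V p i)
    (hfac : ∀ a b j, (exactTilted.β n a + mrow a) - exactTilted.ρ n a ⬝ᵥ (udPt b + q j) = ∑ i, U a i * V (b, j) i) :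
    3 ^ α.card ≤ (r + 1) * 2 ^ α.card := by
  classical
  let row : Finset ↥α → exactTilted.A n := fun a' => (({a₀} : Finset (Fin n)), scTilt a₀ (insert c (embα α a')))
  have hρ : ∀ a', exactTilted.ρ n (row a') = scDir a₀ c α a' := fun _ => rfl
  have hβ : ∀ a', exactTilted.β n (row a') = 1 + hCOR (scTilt a₀ (insert c (embα α a'))) := fun _ => rfl
  unfold ScPartialCommonMax at hpcm
  choose jc hjc using hpcm
  -- the exact slack splits into its COR part (the UDISJ entry) and its nonnegative passenger part
  have hslack : ∀ a' b', ∑ i, U (row a') i * V (insert a₀ (embα α b'), jc b') i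
      = (1 - ((a' ∩ b').card : ℝ)) ^ 2 + (mrow (row a') - scDir a₀ c α a' ⬝ᵥ q (jc b')) := by
    intro a' b'
    rw [← hfac, hρ, hβ, dotProduct_add, ← sc_corSlack α ha₀ hcα hac a' b']
    ring
  have key := three_pow_le_of_pattern U V hU hV row (fun b' => (insert a₀ (embα α b'), jc b')) ?_ ?_
  · have h1 : Fintype.card ↥α = α.card := Fintype.card_coe α
    have h2 : Fintype.card (Option (Fin r)) = r + 1 := by simp
    rw [h1, h2] at key
    exact key
  · intro a' b' h1
    obtain ⟨j, hj⟩ := hm2 (row a')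
    have hle := hjc b' a' h1 j
    have hge := hm1 (row a') (jc b')
    rw [hρ] at hj hge
    have hk : ((a' ∩ b').card : ℝ) = 1 := by exact_mod_cast h1
    rw [hslack, hk]
    have h0 : mrow (row a') - scDir a₀ c α a' ⬝ᵥ q (jc b') = 0 := by linarith
    rw [h0]
    norm_num
  · intro a' b' hab
    have hge := hm1 (row a') (jc b')
    rw [hρ] at hge
    have hk : ((a' ∩ b').card : ℝ) = 0 := by
      rw [Finset.disjoint_iff_inter_eq_empty.mp hab, Finset.card_empty, Nat.cast_zero]
    rw [hslack, hk]
    have h0 : 0 ≤ mrow (row a') - scDir a₀ c α a' ⬝ᵥ q (jc b') := by linarith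
    norm_num
    linarith

/-- ★★★ **C′ ON THE JUNK-TOLERANT CLASS, literal `T c n < r`, for EVERY `n`**: a partial common maximiser per column on ONE anchored
configuration `(a₀, c, α)` with `|α| ≥ 2(log₂ n + c)^c + 4` already decides the passenger under `ExactPencilLaw`'s rows. -/
theorem exactTilted_body_of_partialCommonMax (c₀ n K : ℕ) (q : Fin (K + 1) → (Fin (n * n) → ℝ)) (r : ℕ)
    {a₀ c : Fin n} (α : Finset (Fin n)) (ha₀ : a₀ ∉ α) (hcα : c ∉ α) (hac : a₀ ≠ c)
    (hα : 2 * (Nat.log 2 n + c₀) ^ c₀ + 4 ≤ α.card) (hpcm : ScPartialCommonMax q a₀ c α)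
    (m : exactTilted.A n → ℝ) (hm1 : ∀ a j, exactTilted.ρ n a ⬝ᵥ q j ≤ m a) (hm2 : ∀ a, ∃ j, exactTilted.ρ n a ⬝ᵥ q j = m a)
    (U : exactTilted.A n → Option (Fin r) → ℝ) (V : Finset (Fin n) × Fin (K + 1) → Option (Fin r) → ℝ)
    (hU : ∀ a i, 0 ≤ U a i) (hV : ∀ p i, 0 ≤ V p i)
    (hfac : ∀ a b j, (exactTilted.β n a + m a) - exactTilted.ρ n a ⬝ᵥ (udPt b + q j) = ∑ i, U a i * V (b, j) i) :
    T c₀ n < r :=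
  T_lt_of_block_polylog c₀ n α.card r hα (sc_pattern_block q α ha₀ hcα hac hpcm m hm1 hm2 U V hU hV hfac)

/-- (E17) ⊂ (E18): a passenger with constant off-diagonal shadow on `M ⊇ {a₀, c} ∪ α` has a GLOBAL common maximiser of all anchored
star–clique directions (the maximiser of the anchor coordinate `q_j(a₀,a₀)`), in particular partial ones. -/
theorem scPartialCommonMax_of_offDiagConst {K : ℕ} {q : Fin (K + 1) → (Fin (n * n) → ℝ)} {M : Finset (Fin n)}
    (hq : OffDiagConst M q) {a₀ c : Fin n} (ha₀ : a₀ ∈ M) (hc : c ∈ M) (hac : a₀ ≠ c) (α : Finset (Fin n))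
    (hαM : α ⊆ M) (ha₀α : a₀ ∉ α) : ScPartialCommonMax q a₀ c α := by
  classical
  obtain ⟨j₀, -, hj₀⟩ := Finset.exists_max_image Finset.univ (fun j => udRow ({a₀} : Finset (Fin n)) ⬝ᵥ q j)
    Finset.univ_nonempty
  intro b'
  refine ⟨j₀, fun a' _ j' => ?_⟩
  have hA_a₀ : a₀ ∉ insert c (embα α a') := fun h => by
    rcases Finset.mem_insert.mp h with h | h
    · exact hac h
    · exact ha₀α (mem_of_mem_embα h)
  have hA_M : insert c (embα α a') ⊆ M := fun x hx => by
    rcases Finset.mem_insert.mp hx with rfl | h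
    · exact hc
    · exact hαM (mem_of_mem_embα h)
  unfold scDir
  rw [add_dotProduct, add_dotProduct, scTilt_dot_const hq a₀ hA_a₀ ha₀ hA_M j' j₀]
  have := hj₀ j' (Finset.mem_univ _)
  linarith

/-! ## §4 ★★★ DECIDED, IN THE FLAT SOCKET (xc currency, BY NAME via the tree's pointwise Yannakakis `concl_of_lawBody`)

The shape a `CoreLaw` binder of the line consumes: `HasEFOfSize (COR(n) + conv q) r → T c n < r`.  No `n₀` for the two polylog classes. -/

/-- ★★★ **SHADOW-CONSTANT PASSENGERS ARE DECIDED** (flat socket, every `n`): constant off-diagonal shadow on a minor `M` with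
`|M| ≥ 2(log₂ n + c)^c + 6` and an EF of `COR(n) + conv q` of size `r` force `T c n < r`. -/
theorem offDiagConst_decided (c₀ n K : ℕ) (q : Fin (K + 1) → (Fin (n * n) → ℝ)) (r : ℕ) (M : Finset (Fin n))
    (hM : 2 * (Nat.log 2 n + c₀) ^ c₀ + 6 ≤ M.card) (hq : OffDiagConst M q)
    (hR : HasEFOfSize (corPolytope n + convexHull ℝ (Set.range q)) r) : T c₀ n < r :=
  concl_of_lawBody exactTilted q
    (fun m hm1 hm2 U V hU hV hfac => exactTilted_body_on_offDiagConst_polylog c₀ n K q r M hM hq m hm1 hm2 U V hU hV hfac) hR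

/-- ★★★ **EVERY DIAGONAL PASSENGER IS DECIDED** (flat socket, eventually in `n`): `Q^Π_λ` for every `λ`, every diagonal design / cube /
zonotope — an EF of `COR(n) + conv{flat (diagonal (D j))}` of size `r` forces `T c n < r`. -/
theorem diagonal_decided (c₀ : ℕ) : ∃ n₀ : ℕ, ∀ n ≥ n₀, ∀ (K : ℕ) (D : Fin (K + 1) → Fin n → ℝ) (r : ℕ),
    HasEFOfSize (corPolytope n + convexHull ℝ (Set.range fun j => flat (Matrix.diagonal (D j)))) r → T c₀ n < r := by
  classical
  obtain ⟨n₀, hn₀⟩ := T_lt_of_block' c₀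
  refine ⟨max n₀ 4, fun n hn K D r hR => ?_⟩
  have hn4 : 4 ≤ n := le_of_max_le_right hn
  refine concl_of_lawBody exactTilted (fun j => flat (Matrix.diagonal (D j))) (fun m hm1 hm2 U V hU hV hfac => ?_) hR
  have hcard : 1 < (Finset.univ : Finset (Fin n)).card := by rw [Finset.card_univ, Fintype.card_fin]; omega
  obtain ⟨a₀, -, c, -, hac⟩ := Finset.one_lt_card.mp hcard
  have hblock := sc_block (fun j => flat (Matrix.diagonal (D j))) Finset.univ (offDiagConst_of_diagonal D)
    (Finset.mem_univ a₀) (Finset.mem_univ c) hac m hm1 hm2 U V hU hV hfac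
  rw [Finset.card_univ, Fintype.card_fin] at hblock
  exact hn₀ n (le_of_max_le_left hn) (n - 2) r (by omega) hblock

/-- ★★★ **THE JUNK-TOLERANT CLASS IS DECIDED** (flat socket, every `n`): a partial common maximiser per column on ONE anchored configuration
`(a₀, c, α)` with `|α| ≥ 2(log₂ n + c)^c + 4` and an EF of `COR(n) + conv q` of size `r` force `T c n < r`. -/
theorem partialCommonMax_decided (c₀ n K : ℕ) (q : Fin (K + 1) → (Fin (n * n) → ℝ)) (r : ℕ) {a₀ c : Fin n} (α : Finset (Fin n))
    (ha₀ : a₀ ∉ α) (hcα : c ∉ α) (hac : a₀ ≠ c) (hα : 2 * (Nat.log 2 n + c₀) ^ c₀ + 4 ≤ α.card) (hpcm : ScPartialCommonMax q a₀ c α)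
    (hR : HasEFOfSize (corPolytope n + convexHull ℝ (Set.range q)) r) : T c₀ n < r :=
  concl_of_lawBody exactTilted q
    (fun m hm1 hm2 U V hU hV hfac => exactTilted_body_of_partialCommonMax c₀ n K q r α ha₀ hcα hac hα hpcm m hm1 hm2 U V hU hV hfac) hR

end Part2

end Summit.ValiantsHypothesis.ValiantsHypothesis.Theorems.FifoMatching.ShadowConstRead
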